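import Summits.QuantumAdvantage.QuantumAdvantage.Theorems.CubicForrelationNearExactIsExactTwelveLevelFiveAlphaH3
import Summits.QuantumAdvantage.QuantumAdvantage.Theorems.CubicForrelationNearExactIsExactTwelveWindowShape29

/-!
# Crux `CubicForrelation.NearExactIsExact` (stmt-QuantumAdvantage-14043) — n = 12, open window, a LEVEL-5 side in CASE α:
  on the 8-flat `A₂` the residual is an AFFINE SIGN mod 8 (`e₅ ≡ 2η (mod 8)`, `η = ±(−1)^λ` with `λ` linear)

Certificate seat `b2b-cforr-cert` (gen 30).  HONEST FRAMING: kernel-checked finite-slice lemmas (standard axioms) about cubic Boolean pairs on 12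
bits; third brick of the case-α programme (PLAN-N12-WINDOW-ALPHA.md §A3, in a sharper form than planned there).  NO value of `θ₁₂` is claimed;
NOT summit progress.

Setting (from `tza_window_alpha` / `tz29_window_side_alpha_data`).  Cubic `f, g` on 12 bits, `W_g = 32u'`, `e = e₅ = u' − 2(−1)^f`, odd
hyperplane `P = x₀ ⊕ V` (`#V = 2048`), its complement `c ⊕ V`, `A₂ = {u' even, 4 ∤ e} = c ⊕ V₁` (`V₁ ⊆ V` xor-closed, `#V₁ = 256`), budget
`Σ_P (e² − 1) + Σ_{off P} e² ≤ 1535`.  On `A₂`, `e ≡ 2 (mod 4)`, so `e ≡ 2η (mod 8)` with `η = sZ [e ≡ 6 (mod 8)] = ±1`.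
* `tzb_SR_card`: at most `31` points off `P` and off `A₂` have `e ≠ 0` (`S_R`; each costs `≥ 16` of the `≤ 511` spare units).
* `tzb_clean_value`: a translate `q ⊕ τ` of a point `q ∈ A₂` by `τ ∈ V ∖ V₁` outside `S_R` has `e = 0`.
* `tzb_flat2_mod8` (**the 2-flat congruence**): `8 ∣ e(p) + e(p⊕d) + e(p⊕d') + e(p⊕d⊕d')` for `p ∈ A₂`, `d, d' ∈ V₁`.  [The 5-flat
  congruence `8 ∣ Σ_{5-flat} e` (`l5c_flat5`) on `p ⊕ ⟨t₃, t₂, t₁, d, d'⟩` for a CLEAN transversal triple `t₁, t₂, t₃ ∈ V`: all seven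
  non-trivial combinations lie outside `V₁` and the `28` translated points have `e = 0` (they avoid `S_R`; counting `4·380 < 2048`); what is
  left of the 5-flat sum is the 2-flat sum.]
* `tzb_eta_affine`: hence `hη = [e ≡ 6 (mod 8)]` is relatively AFFINE on `A₂` (`hη(p⊕d⊕d') = hη p ⊕ hη(p⊕d) ⊕ hη(p⊕d')`).
* `tzb_coset_char` (general): the character sum of a relatively affine sign over a coset `x₁ ⊕ V₁` is `0` or `±#V₁`;
  `tzb_eta_char`: `Σ_{x∈A₂} η(x)(−1)^{x·y} ∈ {0, ±256}` for every `y`.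

References: J. Ax (1964) / R. J. McEliece (1972) (flat congruences, in the tree as `l5c_flat5`); MacWilliams–Sloane (1977) Ch. 13 §3;
R. O'Donnell (2014) §1.4 (characters of subgroups).  Axioms: the standard three.
-/

set_option linter.dupNamespace false -- D-0017: single-problem summit ⇒ `QuantumAdvantage.QuantumAdvantage` by design

noncomputable section

namespace Summit.QuantumAdvantage.QuantumAdvantage.Theorems.CubicForrelation.NearExactIsExact

open Finset
open Literature.Computability.QuantumComplexity
open Literature.Computability.QuantumComplexity.BuzetChailloux (bxor zeroVec bxor_bxor_cancel_left bxor_zeroVec zeroVec_bxor bxor_comm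
  bxor_self)
open Literature.Computability.QuantumComplexity.DerivativeWalsh (W twist_bxor_left)
open Literature.Computability.QuantumComplexity.Simon (twist_eq_one_or)
open Summit.QuantumAdvantage.QuantumAdvantage.Theorems.CubicForrelation.ExactPairsMaioranaMcFarland (dv_bxor_right_comm)

/-! ### Small tools -/

/-- **The parametrised 1-flat sum, written out.** [folklore] -/
theorem tzb_sum1 {n : ℕ} (F : (Fin n → Bool) → ℤ) (x b : Fin n → Bool) :
    ∑ ε : Fin 1 → Bool, F (fun j => x j ^^ decide (Odd #(univ.filter fun i =>
        ε i && (![b] : Fin 1 → Fin n → Bool) i j))) = F x + F (bxor x b) := by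
  have e : (![b] : Fin 1 → Fin n → Bool) = Matrix.vecCons b ![] := rfl
  rw [e, fr_sum_peel F x b ![]]
  simp only [Fintype.sum_unique, tep_flatPt_nil]

/-- **The parametrised 2-flat sum, written out.** [folklore] -/
theorem tzb_sum2 {n : ℕ} (F : (Fin n → Bool) → ℤ) (x a b : Fin n → Bool) :
    ∑ ε : Fin 2 → Bool, F (fun j => x j ^^ decide (Odd #(univ.filter fun i =>
        ε i && (![a, b] : Fin 2 → Fin n → Bool) i j))) =
      F x + F (bxor x b) + (F (bxor x a) + F (bxor (bxor x b) a)) := by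
  have e : (![a, b] : Fin 2 → Fin n → Bool) = Matrix.vecCons a ![b] := rfl
  rw [e, fr_sum_peel F x a ![b], tzb_sum1 F x b, tzb_sum1 (fun z => F (bxor z a)) x b]

/-- Four residues `≡ 2 (mod 4)` summing to `0 (mod 8)`: an even number of them are `≡ 6 (mod 8)`. [folklore] -/
theorem tzb_xor4 {a b c d : ℤ} (ha : a % 4 = 2) (hb : b % 4 = 2) (hc : c % 4 = 2) (hd : d % 4 = 2)
    (h : (8 : ℤ) ∣ a + b + c + d) :
    decide (d % 8 = 6) = (decide (a % 8 = 6) ^^ decide (b % 8 = 6) ^^ decide (c % 8 = 6)) := by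
  by_cases h1 : a % 8 = 6 <;> by_cases h2 : b % 8 = 6 <;> by_cases h3 : c % 8 = 6 <;> by_cases h4 : d % 8 = 6 <;>
    simp [h1, h2, h3, h4] <;> omega

/-- On `A₂` (`e ≡ 2 (mod 4)`): `8 ∣ e − 2·sZ [e ≡ 6 (mod 8)]`. [folklore] -/
theorem tzb_eta_mod8 {e : ℤ} (h2 : e % 4 = 2) : (8 : ℤ) ∣ e - 2 * sZ (decide (e % 8 = 6)) := by
  by_cases h : e % 8 = 6
  · rw [decide_eq_true h, show sZ true = -1 from rfl]; omega
  · rw [decide_eq_false h, show sZ false = 1 from rfl]; omega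

/-- Membership in `A₂ = {u' even, 4 ∤ e}` as a residue: `e ≡ 2 (mod 4)`. [folklore] -/
theorem tzb_A2_mod4 (f : (Fin (6 + 6) → Bool) → Bool) (u' : (Fin (6 + 6) → Bool) → ℤ) {y : Fin (6 + 6) → Bool}
    (hy : ¬ Odd (u' y)) (hy4 : ¬ (4 : ℤ) ∣ u' y - 2 * sZ (f y)) : (u' y - 2 * sZ (f y)) % 4 = 2 := by
  obtain ⟨m, hm⟩ := Int.not_odd_iff_even.1 hy
  have hs := tp_sZ_cases (f y)
  rcases hs with hs | hs <;> rw [hs] <;> omega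

/-! ### Budget consequences on the window in case α -/

/-- **At most `31` stray points off the hyperplane.**  With `A₂ = c ⊕ V₁` (`#V₁ = 256`, each point costs `e² ≥ 4`) and the window budget
`Σ_P (e² − 1) + Σ_{off P} e² ≤ 1535`, the set `S_R = {u' even, 4 ∣ e, e ≠ 0}` (each point costs `≥ 16`) has at most `31` points.
[this work] -/
theorem tzb_SR_card (f : (Fin (6 + 6) → Bool) → Bool) (u' : (Fin (6 + 6) → Bool) → ℤ)
    (c : Fin (6 + 6) → Bool) (V₁ : Finset (Fin (6 + 6) → Bool)) (h1card : #V₁ = 256)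
    (hA2 : (univ.filter fun y : Fin (6 + 6) → Bool => ¬ Odd (u' y) ∧ ¬ (4 : ℤ) ∣ u' y - 2 * sZ (f y)) = V₁.image (bxor c))
    (hbud : ∑ x ∈ univ.filter (fun x : Fin (6 + 6) → Bool => Odd (u' x)), ((u' x - 2 * sZ (f x)) ^ 2 - 1) +
        ∑ y ∈ univ.filter (fun y : Fin (6 + 6) → Bool => ¬ Odd (u' y)), (u' y - 2 * sZ (f y)) ^ 2 ≤ 1535) :
    #(univ.filter fun y : Fin (6 + 6) → Bool =>
        ¬ Odd (u' y) ∧ (4 : ℤ) ∣ u' y - 2 * sZ (f y) ∧ u' y - 2 * sZ (f y) ≠ 0) ≤ 31 := by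
  classical
  set e : (Fin (6 + 6) → Bool) → ℤ := fun x => u' x - 2 * sZ (f x) with hedef
  set P := univ.filter (fun x : Fin (6 + 6) → Bool => Odd (u' x)) with hPdef
  set P' := univ.filter (fun y : Fin (6 + 6) → Bool => ¬ Odd (u' y)) with hP'def
  set A₂ := univ.filter (fun y : Fin (6 + 6) → Bool => ¬ Odd (u' y) ∧ ¬ (4 : ℤ) ∣ e y) with hA₂def
  set SR := univ.filter (fun y : Fin (6 + 6) → Bool => ¬ Odd (u' y) ∧ (4 : ℤ) ∣ e y ∧ e y ≠ 0) with hSRdef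
  have heodd : ∀ x ∈ P, Odd (e x) := fun x hx =>
    Int.odd_sub.2 (iff_of_true (mem_filter.1 hx).2 ⟨sZ (f x), two_mul _⟩)
  have hP0 : 0 ≤ ∑ x ∈ P, (e x ^ 2 - 1) := by
    refine sum_nonneg fun x hx => ?_
    have h1 := Int.odd_iff.1 (heodd x hx)
    have : e x ≤ -1 ∨ 1 ≤ e x := by omega
    rcases this with h | h <;> nlinarith
  have hA2card : #A₂ = 256 := by
    rw [hA2, card_image_of_injective _ (iw_bxor_injective c), h1card]
  have hdisj : Disjoint A₂ SR := by
    rw [disjoint_filter]; intro y _ h h'; exact h.2 h'.2.1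
  have hsub : A₂ ∪ SR ⊆ P' := by
    intro y hy
    rcases mem_union.1 hy with h | h
    · exact mem_filter.2 ⟨mem_univ _, (mem_filter.1 h).2.1⟩
    · exact mem_filter.2 ⟨mem_univ _, (mem_filter.1 h).2.1⟩
  have h1 : ∑ y ∈ A₂ ∪ SR, e y ^ 2 ≤ ∑ y ∈ P', e y ^ 2 :=
    sum_le_sum_of_subset_of_nonneg hsub fun _ _ _ => sq_nonneg _
  rw [sum_union hdisj] at h1
  have hA : ∀ y ∈ A₂, (4 : ℤ) ≤ e y ^ 2 := by
    intro y hy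
    obtain ⟨-, hy1, hy4⟩ := mem_filter.1 hy
    have h2 := tzb_A2_mod4 f u' hy1 hy4
    have : e y ≤ -2 ∨ 2 ≤ e y := by simp only [e]; omega
    rcases this with h | h <;> nlinarith
  have hS : ∀ y ∈ SR, (16 : ℤ) ≤ e y ^ 2 := by
    intro y hy
    obtain ⟨-, -, ⟨k, hk⟩, hne⟩ := mem_filter.1 hy
    have hk0 : k ≠ 0 := by rintro rfl; exact hne (by rw [hk, mul_zero])
    have : k ≤ -1 ∨ 1 ≤ k := by omega
    rw [hk]
    rcases this with h | h <;> nlinarith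
  have hAsum : 4 * (256 : ℤ) ≤ ∑ y ∈ A₂, e y ^ 2 := by
    have h := sum_le_sum hA
    rw [sum_const, hA2card, nsmul_eq_mul] at h
    push_cast at h
    linarith
  have hSsum : 16 * (#SR : ℤ) ≤ ∑ y ∈ SR, e y ^ 2 := by
    have h := sum_le_sum hS
    rw [sum_const, nsmul_eq_mul] at h
    linarith
  have hbud' : ∑ x ∈ P, (e x ^ 2 - 1) + ∑ y ∈ P', e y ^ 2 ≤ 1535 := hbud
  have : 16 * (#SR : ℤ) ≤ 511 := by linarith
  have : (#SR : ℤ) ≤ 31 := by omega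
  exact_mod_cast this

/-! ### Clean translates -/

/-- **Clean value.**  `A₂ = c ⊕ V₁`, `{u' even} = c ⊕ V`: a translate `q ⊕ τ` of `q ∈ A₂` by `τ ∈ V ∖ V₁` that is not a stray point has
`e(q ⊕ τ) = 0` (it lies off `P` and off `A₂`, so `4 ∣ e`, and `e ≠ 0` would make it stray). [this work] -/
theorem tzb_clean_value (f : (Fin (6 + 6) → Bool) → Bool) (u' : (Fin (6 + 6) → Bool) → ℤ)
    (V : Finset (Fin (6 + 6) → Bool)) (c : Fin (6 + 6) → Bool) (V₁ : Finset (Fin (6 + 6) → Bool)) (hsub : V₁ ⊆ V)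
    (h1add : ∀ a ∈ V₁, ∀ b ∈ V₁, bxor a b ∈ V₁)
    (hPc : (univ.filter fun x : Fin (6 + 6) → Bool => ¬ Odd (u' x)) = V.image (bxor c))
    (hadd : ∀ a ∈ V, ∀ b ∈ V, bxor a b ∈ V)
    (hA2 : (univ.filter fun y : Fin (6 + 6) → Bool => ¬ Odd (u' y) ∧ ¬ (4 : ℤ) ∣ u' y - 2 * sZ (f y)) = V₁.image (bxor c))
    {q τ : Fin (6 + 6) → Bool} (hq : q ∈ V₁.image (bxor c)) (hτ : τ ∈ V) (hτ1 : τ ∉ V₁)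
    (hSR : bxor q τ ∉ univ.filter fun y : Fin (6 + 6) → Bool =>
        ¬ Odd (u' y) ∧ (4 : ℤ) ∣ u' y - 2 * sZ (f y) ∧ u' y - 2 * sZ (f y) ≠ 0) :
    u' (bxor q τ) - 2 * sZ (f (bxor q τ)) = 0 := by
  classical
  obtain ⟨v₁, hv₁, rfl⟩ := mem_image.1 hq
  -- off `P`
  have hoff : bxor (bxor c v₁) τ ∈ V.image (bxor c) :=
    mem_image.2 ⟨bxor v₁ τ, hadd v₁ (hsub hv₁) τ hτ, by rw [iw_bxor_assoc]⟩
  rw [← hPc] at hoff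
  have hev : ¬ Odd (u' (bxor (bxor c v₁) τ)) := (mem_filter.1 hoff).2
  -- off `A₂`
  have hnotA : bxor (bxor c v₁) τ ∉ V₁.image (bxor c) := by
    intro h
    obtain ⟨w, hw, hw'⟩ := mem_image.1 h
    have key : bxor v₁ w = τ := by
      have h' := congrArg (bxor (bxor c v₁)) hw'
      rw [bxor_bxor_cancel_left] at h'
      rw [← h']
      funext j
      show (v₁ j ^^ w j) = ((c j ^^ v₁ j) ^^ (c j ^^ w j))
      cases c j <;> cases v₁ j <;> cases w j <;> rfl
    exact hτ1 (key ▸ h1add v₁ hv₁ w hw)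
  rw [← hA2] at hnotA
  have h4 : (4 : ℤ) ∣ u' (bxor (bxor c v₁) τ) - 2 * sZ (f (bxor (bxor c v₁) τ)) := by
    by_contra h4
    exact hnotA (mem_filter.2 ⟨mem_univ _, hev, h4⟩)
  by_contra hne
  exact hSR (mem_filter.2 ⟨mem_univ _, hev, h4, hne⟩)

/-! ### The 2-flat congruence on `A₂` -/

/-- **The 2-flat congruence in case α.**  On the window (`Σ_P (e² − 1) + Σ_{off P} e² ≤ 1535`) with `A₂ = c ⊕ V₁` an 8-flat: for `p ∈ A₂` and
`d, d' ∈ V₁`, `8 ∣ e(p) + e(p ⊕ d) + e(p ⊕ d') + e(p ⊕ d ⊕ d')`.  [`l5c_flat5` on the 5-flat `p ⊕ ⟨t₃, t₂, t₁, d, d'⟩` for a clean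
transversal triple.]  Finite-slice statement, NOT summit progress. [this work] -/
theorem tzb_flat2_mod8 (f g : (Fin (6 + 6) → Bool) → Bool) (hf : IsDegLeFun 3 f) (hg : IsDegLeFun 3 g)
    (u' : (Fin (6 + 6) → Bool) → ℤ) (hu' : ∀ x, W (fun y => signOf (g y)) x = (2 : ℝ) ^ 5 * (u' x : ℝ))
    (V : Finset (Fin (6 + 6) → Bool)) (hadd : ∀ a ∈ V, ∀ b ∈ V, bxor a b ∈ V) (hcardV : #V = 2048)
    (c : Fin (6 + 6) → Bool) (V₁ : Finset (Fin (6 + 6) → Bool)) (hsub : V₁ ⊆ V)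
    (h1add : ∀ a ∈ V₁, ∀ b ∈ V₁, bxor a b ∈ V₁) (h1card : #V₁ = 256)
    (hPc : (univ.filter fun x : Fin (6 + 6) → Bool => ¬ Odd (u' x)) = V.image (bxor c))
    (hA2 : (univ.filter fun y : Fin (6 + 6) → Bool => ¬ Odd (u' y) ∧ ¬ (4 : ℤ) ∣ u' y - 2 * sZ (f y)) = V₁.image (bxor c))
    (hbud : ∑ x ∈ univ.filter (fun x : Fin (6 + 6) → Bool => Odd (u' x)), ((u' x - 2 * sZ (f x)) ^ 2 - 1) +
        ∑ y ∈ univ.filter (fun y : Fin (6 + 6) → Bool => ¬ Odd (u' y)), (u' y - 2 * sZ (f y)) ^ 2 ≤ 1535)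
    {p d d' : Fin (6 + 6) → Bool} (hp : p ∈ V₁.image (bxor c)) (hd : d ∈ V₁) (hd' : d' ∈ V₁) :
    (8 : ℤ) ∣ (u' p - 2 * sZ (f p)) + (u' (bxor p d) - 2 * sZ (f (bxor p d))) +
      (u' (bxor p d') - 2 * sZ (f (bxor p d'))) + (u' (bxor (bxor p d) d') - 2 * sZ (f (bxor (bxor p d) d'))) := by
  classical
  set e : (Fin (6 + 6) → Bool) → ℤ := fun x => u' x - 2 * sZ (f x) with hedef
  set A₂ := V₁.image (bxor c) with hA₂def
  set SR := univ.filter (fun y : Fin (6 + 6) → Bool => ¬ Odd (u' y) ∧ (4 : ℤ) ∣ e y ∧ e y ≠ 0) with hSRdef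
  have hSR : #SR ≤ 31 := tzb_SR_card f u' c V₁ h1card hA2 hbud
  have hA₂V₁ : ∀ q ∈ A₂, ∀ w ∈ V₁, bxor q w ∈ A₂ := fun q hq w hw => fl1_coset_vadd h1add rfl hq hw
  have hclean : ∀ q ∈ A₂, ∀ τ ∈ V, τ ∉ V₁ → bxor q τ ∉ SR → e (bxor q τ) = 0 :=
    fun q hq τ hτ hτ1 hS => tzb_clean_value f u' V c V₁ hsub h1add hPc hadd hA2 hq hτ hτ1 hS
  -- the four points of the 2-flat
  have hq1 : bxor p d' ∈ A₂ := hA₂V₁ p hp d' hd'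
  have hq2 : bxor p d ∈ A₂ := hA₂V₁ p hp d hd
  have hq3 : bxor (bxor p d') d ∈ A₂ := hA₂V₁ _ hq1 d hd
  -- the forbidden directions
  set BAD := V₁ ∪ (SR.image (bxor p) ∪ (SR.image (bxor (bxor p d')) ∪ (SR.image (bxor (bxor p d)) ∪
    SR.image (bxor (bxor (bxor p d') d))))) with hBADdef
  have hBADcard : #BAD ≤ 380 := by
    have hu : #BAD ≤ #V₁ + (#SR + (#SR + (#SR + #SR))) := by
      refine (card_union_le _ _).trans (Nat.add_le_add_left ?_ _)
      refine (card_union_le _ _).trans (Nat.add_le_add card_image_le ?_)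
      refine (card_union_le _ _).trans (Nat.add_le_add card_image_le ?_)
      exact (card_union_le _ _).trans (Nat.add_le_add card_image_le card_image_le)
    rw [h1card] at hu
    omega
  -- a good direction kills the translated 2-flat sum
  have hnotSR : ∀ q τ : Fin (6 + 6) → Bool, τ ∉ SR.image (bxor q) → bxor q τ ∉ SR := by
    intro q τ h hmem
    exact h (mem_image.2 ⟨bxor q τ, hmem, bxor_bxor_cancel_left q τ⟩)
  have hgood : ∀ τ ∈ V, τ ∉ BAD →
      ∑ ε : Fin 2 → Bool, e (fun j => (bxor p τ) j ^^ decide (Odd #(univ.filter fun i =>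
        ε i && (![d, d'] : Fin 2 → Fin (6 + 6) → Bool) i j))) = 0 := by
    intro τ hτ hB
    simp only [hBADdef, mem_union, not_or] at hB
    obtain ⟨hτ1, hB0, hB1, hB2, hB3⟩ := hB
    rw [tzb_sum2, dv_bxor_right_comm p τ d', dv_bxor_right_comm p τ d, dv_bxor_right_comm (bxor p d') τ d,
      hclean p hp τ hτ hτ1 (hnotSR p τ hB0), hclean _ hq1 τ hτ hτ1 (hnotSR _ τ hB1),
      hclean _ hq2 τ hτ hτ1 (hnotSR _ τ hB2), hclean _ hq3 τ hτ hτ1 (hnotSR _ τ hB3)]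
    norm_num
  -- choosing the clean transversal triple
  obtain ⟨t₁, ht₁V, ht₁B⟩ : ∃ t, t ∈ V ∧ t ∉ BAD := exists_mem_notMem_of_card_lt_card (by rw [hcardV]; omega)
  have himg : ∀ (w t : Fin (6 + 6) → Bool), t ∉ BAD.image (fun s => bxor s w) → bxor t w ∉ BAD := by
    intro w t h hmem
    refine h (mem_image.2 ⟨bxor t w, hmem, ?_⟩)
    show bxor (bxor t w) w = t
    rw [iw_bxor_assoc, bxor_self, bxor_zeroVec]
  set BAD₂ := BAD ∪ BAD.image (fun s => bxor s t₁) with hBAD₂def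
  have hBAD₂card : #BAD₂ ≤ 760 := by
    have hu : #BAD₂ ≤ #BAD + #BAD := (card_union_le _ _).trans (Nat.add_le_add_left card_image_le _)
    omega
  obtain ⟨t₂, ht₂V, ht₂B⟩ : ∃ t, t ∈ V ∧ t ∉ BAD₂ := exists_mem_notMem_of_card_lt_card (by rw [hcardV]; omega)
  simp only [hBAD₂def, mem_union, not_or] at ht₂B
  obtain ⟨ht₂B, ht₂₁B⟩ := ht₂B
  have ht₂₁ : bxor t₂ t₁ ∉ BAD := himg t₁ t₂ ht₂₁B
  set BAD₃ := BAD ∪ (BAD.image (fun s => bxor s t₁) ∪ (BAD.image (fun s => bxor s t₂) ∪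
    BAD.image (fun s => bxor s (bxor t₂ t₁)))) with hBAD₃def
  have hBAD₃card : #BAD₃ ≤ 1520 := by
    have hu : #BAD₃ ≤ #BAD + (#BAD + (#BAD + #BAD)) := by
      refine (card_union_le _ _).trans (Nat.add_le_add_left ?_ _)
      refine (card_union_le _ _).trans (Nat.add_le_add card_image_le ?_)
      exact (card_union_le _ _).trans (Nat.add_le_add card_image_le card_image_le)
    omega
  obtain ⟨t₃, ht₃V, ht₃B⟩ : ∃ t, t ∈ V ∧ t ∉ BAD₃ := exists_mem_notMem_of_card_lt_card (by rw [hcardV]; omega)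
  simp only [hBAD₃def, mem_union, not_or] at ht₃B
  obtain ⟨ht₃B, ht₃₁B, ht₃₂B, ht₃₂₁B⟩ := ht₃B
  have ht₃₁ : bxor t₃ t₁ ∉ BAD := himg t₁ t₃ ht₃₁B
  have ht₃₂ : bxor t₃ t₂ ∉ BAD := himg t₂ t₃ ht₃₂B
  have ht₃₂₁ : bxor t₃ (bxor t₂ t₁) ∉ BAD := himg (bxor t₂ t₁) t₃ ht₃₂₁B
  -- membership in `V` of the combinations
  have h21V : bxor t₂ t₁ ∈ V := hadd t₂ ht₂V t₁ ht₁V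
  have h31V : bxor t₃ t₁ ∈ V := hadd t₃ ht₃V t₁ ht₁V
  have h32V : bxor t₃ t₂ ∈ V := hadd t₃ ht₃V t₂ ht₂V
  have h321V : bxor t₃ (bxor t₂ t₁) ∈ V := hadd t₃ ht₃V _ h21V
  -- the 5-flat congruence, peeled three times
  have h8 := l5c_flat5 f g hf hg u' hu' p ![t₃, t₂, t₁, d, d']
  change (8 : ℤ) ∣ ∑ ε : Fin 5 → Bool, e (fun j => p j ^^ decide (Odd #(univ.filter fun i =>
      ε i && (![t₃, t₂, t₁, d, d'] : Fin 5 → Fin (6 + 6) → Bool) i j))) at h8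
  have e5 : (![t₃, t₂, t₁, d, d'] : Fin 5 → Fin (6 + 6) → Bool) = Fin.cons t₃ ![t₂, t₁, d, d'] := rfl
  have e4 : (![t₂, t₁, d, d'] : Fin 4 → Fin (6 + 6) → Bool) = Fin.cons t₂ ![t₁, d, d'] := rfl
  have e3 : (![t₁, d, d'] : Fin 3 → Fin (6 + 6) → Bool) = Fin.cons t₁ ![d, d'] := rfl
  rw [e5, l5c_sum_split e p t₃ ![t₂, t₁, d, d'], e4, l5c_sum_split e p t₂ ![t₁, d, d'],
    l5c_sum_split e (bxor p t₃) t₂ ![t₁, d, d'], e3, l5c_sum_split e p t₁ ![d, d'],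
    l5c_sum_split e (bxor p t₂) t₁ ![d, d'], l5c_sum_split e (bxor p t₃) t₁ ![d, d'],
    l5c_sum_split e (bxor (bxor p t₃) t₂) t₁ ![d, d']] at h8
  rw [iw_bxor_assoc (bxor p t₃) t₂ t₁, iw_bxor_assoc p t₃ (bxor t₂ t₁), iw_bxor_assoc p t₃ t₂, iw_bxor_assoc p t₃ t₁,
    iw_bxor_assoc p t₂ t₁] at h8
  rw [hgood t₁ ht₁V ht₁B, hgood t₂ ht₂V ht₂B, hgood _ h21V ht₂₁, hgood t₃ ht₃V ht₃B, hgood _ h31V ht₃₁,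
    hgood _ h32V ht₃₂, hgood _ h321V ht₃₂₁, tzb_sum2] at h8
  simp only [add_zero] at h8
  have ecomm : bxor (bxor p d') d = bxor (bxor p d) d' := dv_bxor_right_comm p d' d
  rw [ecomm] at h8
  simp only [e] at h8
  omega

/-! ### `η` is relatively affine on `A₂` -/

/-- **`hη = [e ≡ 6 (mod 8)]` is relatively affine on `A₂`** (on the window in case α): for `p ∈ A₂ = c ⊕ V₁` and `d, d' ∈ V₁`,
`hη(p ⊕ d ⊕ d') = hη(p) ⊕ hη(p ⊕ d) ⊕ hη(p ⊕ d')`.  Finite-slice statement, NOT summit progress. [this work] -/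
theorem tzb_eta_affine (f g : (Fin (6 + 6) → Bool) → Bool) (hf : IsDegLeFun 3 f) (hg : IsDegLeFun 3 g)
    (u' : (Fin (6 + 6) → Bool) → ℤ) (hu' : ∀ x, W (fun y => signOf (g y)) x = (2 : ℝ) ^ 5 * (u' x : ℝ))
    (V : Finset (Fin (6 + 6) → Bool)) (hadd : ∀ a ∈ V, ∀ b ∈ V, bxor a b ∈ V) (hcardV : #V = 2048)
    (c : Fin (6 + 6) → Bool) (V₁ : Finset (Fin (6 + 6) → Bool)) (hsub : V₁ ⊆ V)
    (h1add : ∀ a ∈ V₁, ∀ b ∈ V₁, bxor a b ∈ V₁) (h1card : #V₁ = 256)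
    (hPc : (univ.filter fun x : Fin (6 + 6) → Bool => ¬ Odd (u' x)) = V.image (bxor c))
    (hA2 : (univ.filter fun y : Fin (6 + 6) → Bool => ¬ Odd (u' y) ∧ ¬ (4 : ℤ) ∣ u' y - 2 * sZ (f y)) = V₁.image (bxor c))
    (hbud : ∑ x ∈ univ.filter (fun x : Fin (6 + 6) → Bool => Odd (u' x)), ((u' x - 2 * sZ (f x)) ^ 2 - 1) +
        ∑ y ∈ univ.filter (fun y : Fin (6 + 6) → Bool => ¬ Odd (u' y)), (u' y - 2 * sZ (f y)) ^ 2 ≤ 1535)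
    {p d d' : Fin (6 + 6) → Bool} (hp : p ∈ V₁.image (bxor c)) (hd : d ∈ V₁) (hd' : d' ∈ V₁) :
    decide ((u' (bxor (bxor p d) d') - 2 * sZ (f (bxor (bxor p d) d'))) % 8 = 6) =
      (decide ((u' p - 2 * sZ (f p)) % 8 = 6) ^^ decide ((u' (bxor p d) - 2 * sZ (f (bxor p d))) % 8 = 6) ^^
        decide ((u' (bxor p d') - 2 * sZ (f (bxor p d'))) % 8 = 6)) := by
  classical
  have h8 := tzb_flat2_mod8 f g hf hg u' hu' V hadd hcardV c V₁ hsub h1add h1card hPc hA2 hbud hp hd hd'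
  have hA₂V₁ : ∀ q ∈ V₁.image (bxor c), ∀ w ∈ V₁, bxor q w ∈ V₁.image (bxor c) :=
    fun q hq w hw => fl1_coset_vadd h1add rfl hq hw
  have hmod : ∀ q ∈ V₁.image (bxor c), (u' q - 2 * sZ (f q)) % 4 = 2 := by
    intro q hq
    rw [← hA2] at hq
    obtain ⟨-, hq1, hq4⟩ := mem_filter.1 hq
    exact tzb_A2_mod4 f u' hq1 hq4
  exact tzb_xor4 (hmod p hp) (hmod _ (hA₂V₁ p hp d hd)) (hmod _ (hA₂V₁ p hp d' hd'))
    (hmod _ (hA₂V₁ _ (hA₂V₁ p hp d hd) d' hd')) h8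

/-! ### Character sums of relatively affine signs over a coset -/

/-- **Character sum of a relatively affine sign over a coset.**  `V₁` xor-closed, `h` Boolean with
`h(x₁ ⊕ w ⊕ w') = h(x₁) ⊕ h(x₁ ⊕ w) ⊕ h(x₁ ⊕ w')` for `w, w' ∈ V₁`.  Then for every `y`,
`Σ_{x ∈ x₁ ⊕ V₁} (−1)^{h(x)} (−1)^{x·y} = k·#V₁` with `k ∈ {0, 1, −1}`. [folklore] -/
theorem tzb_coset_char {n : ℕ} (V₁ : Finset (Fin n → Bool)) (h1add : ∀ a ∈ V₁, ∀ b ∈ V₁, bxor a b ∈ V₁)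
    (x₁ : Fin n → Bool) (h : (Fin n → Bool) → Bool)
    (haff : ∀ w ∈ V₁, ∀ w' ∈ V₁, h (bxor (bxor x₁ w) w') = (h x₁ ^^ h (bxor x₁ w) ^^ h (bxor x₁ w')))
    (y : Fin n → Bool) :
    ∃ k : ℤ, (k = 0 ∨ k = 1 ∨ k = -1) ∧ ∑ x ∈ V₁.image (bxor x₁), signOf (h x) * twist x y = (k : ℝ) * #V₁ := by
  classical
  rw [sum_image fun a _ b _ hab => iw_bxor_injective x₁ hab]
  set ψ : (Fin n → Bool) → ℝ := fun w => signOf (h x₁ ^^ h (bxor x₁ w)) * twist w y with hψ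
  have hfac : ∀ w, signOf (h (bxor x₁ w)) * twist (bxor x₁ w) y = (signOf (h x₁) * twist x₁ y) * ψ w := by
    intro w
    simp only [ψ]
    rw [twist_bxor_left]
    cases h x₁ <;> cases h (bxor x₁ w) <;> simp [signOf]
  rw [sum_congr rfl fun w _ => hfac w, ← mul_sum]
  have h1 : ∀ w ∈ V₁, ψ w = 1 ∨ ψ w = -1 := by
    intro w _
    simp only [ψ]
    rcases twist_eq_one_or w y with ht | ht <;> cases (h x₁ ^^ h (bxor x₁ w)) <;> simp [signOf, ht]
  have hmul : ∀ w ∈ V₁, ∀ w' ∈ V₁, ψ (bxor w w') = ψ w * ψ w' := by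
    intro w hw w' hw'
    simp only [ψ]
    rw [twist_bxor_left, ← iw_bxor_assoc, haff w hw w' hw']
    have hx : signOf (h x₁) * signOf (h x₁) = 1 := by cases h x₁ <;> simp [signOf]
    have e1 : signOf (h x₁ ^^ (h x₁ ^^ h (bxor x₁ w) ^^ h (bxor x₁ w'))) =
        signOf (h x₁ ^^ h (bxor x₁ w)) * signOf (h x₁ ^^ h (bxor x₁ w')) := by
      cases h x₁ <;> cases h (bxor x₁ w) <;> cases h (bxor x₁ w') <;> simp [signOf]
    rw [e1]; ring
  have hs : signOf (h x₁) * twist x₁ y = 1 ∨ signOf (h x₁) * twist x₁ y = -1 := by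
    rcases twist_eq_one_or x₁ y with ht | ht <;> cases h x₁ <;> simp [signOf, ht]
  rcases bd_hom_sum V₁ h1add ψ h1 hmul with h0 | hV
  · exact ⟨0, Or.inl rfl, by rw [h0]; simp⟩
  · rw [hV]
    rcases hs with hs | hs
    · exact ⟨1, Or.inr (Or.inl rfl), by rw [hs]; simp⟩
    · exact ⟨-1, Or.inr (Or.inr rfl), by rw [hs]; simp⟩

/-- **`Σ_{x∈A₂} η(x)(−1)^{x·y} ∈ {0, ±256}`** on the window in case α (`η = sZ ∘ hη`, `hη = [e ≡ 6 (mod 8)]` relatively affine on the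
8-flat `A₂ = c ⊕ V₁`).  Finite-slice statement, NOT summit progress. [this work] -/
theorem tzb_eta_char (f g : (Fin (6 + 6) → Bool) → Bool) (hf : IsDegLeFun 3 f) (hg : IsDegLeFun 3 g)
    (u' : (Fin (6 + 6) → Bool) → ℤ) (hu' : ∀ x, W (fun y => signOf (g y)) x = (2 : ℝ) ^ 5 * (u' x : ℝ))
    (V : Finset (Fin (6 + 6) → Bool)) (hadd : ∀ a ∈ V, ∀ b ∈ V, bxor a b ∈ V) (hcardV : #V = 2048)
    (c : Fin (6 + 6) → Bool) (V₁ : Finset (Fin (6 + 6) → Bool)) (hsub : V₁ ⊆ V)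
    (h1add : ∀ a ∈ V₁, ∀ b ∈ V₁, bxor a b ∈ V₁) (h1card : #V₁ = 256)
    (hPc : (univ.filter fun x : Fin (6 + 6) → Bool => ¬ Odd (u' x)) = V.image (bxor c))
    (hA2 : (univ.filter fun y : Fin (6 + 6) → Bool => ¬ Odd (u' y) ∧ ¬ (4 : ℤ) ∣ u' y - 2 * sZ (f y)) = V₁.image (bxor c))
    (hbud : ∑ x ∈ univ.filter (fun x : Fin (6 + 6) → Bool => Odd (u' x)), ((u' x - 2 * sZ (f x)) ^ 2 - 1) +
        ∑ y ∈ univ.filter (fun y : Fin (6 + 6) → Bool => ¬ Odd (u' y)), (u' y - 2 * sZ (f y)) ^ 2 ≤ 1535)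
    (y : Fin (6 + 6) → Bool) :
    ∃ k : ℤ, (k = 0 ∨ k = 1 ∨ k = -1) ∧
      ∑ x ∈ V₁.image (bxor c), signOf (decide ((u' x - 2 * sZ (f x)) % 8 = 6)) * twist x y = (k : ℝ) * 256 := by
  have h := tzb_coset_char V₁ h1add c (fun z => decide ((u' z - 2 * sZ (f z)) % 8 = 6))
    (fun w hw w' hw' => tzb_eta_affine f g hf hg u' hu' V hadd hcardV c V₁ hsub h1add h1card hPc hA2 hbud
      (mem_image.2 ⟨zeroVec, ?_, bxor_zeroVec c⟩) hw hw') y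
  · rw [h1card] at h
    push_cast at h
    exact h
  · -- `0 ∈ V₁`: `V₁` is non-empty and xor-closed
    have hne : V₁.Nonempty := by rw [← card_pos, h1card]; norm_num
    obtain ⟨w, hw⟩ := hne
    have := h1add w hw w hw
    rwa [bxor_self] at this

end Summit.QuantumAdvantage.QuantumAdvantage.Theorems.CubicForrelation.NearExactIsExact

end
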